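import Literature.Geometry.DiscreteGeometry.SphericalIsoperimetric

/-!
# L. Fejes Tóth's sphere-covering theorem (one named fact)

If `n ≥ 3` congruent closed spherical caps cover the unit sphere `S² ⊂ ℝ³`, their angular radius is at least
`arccos (cot ω_n / √3)`, `ω_n = nπ / (6(n − 2))`; equality exactly for `n = 3, 4, 6, 12` (L. Fejes Tóth 1943;
*Lagerungen in der Ebene, auf der Kugel und im Raum* (1953), Kap. V).  This is the COVERING twin of the Tammes-problem
bound `Literature.Geometry.DiscreteGeometry.fejesToth_inner_bound` (`FejesTothTammesBound.lean`, proved there from the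
Delone triangulation); it is typed here with the same `ω_n`, over an indexed family `a : Fin n → ℝ³` of unit cap
centres ("`n` caps"; repetitions allowed, as in print), with the closed caps `sphCap` of `SphericalIsoperimetric.lean`.

## Content
* `FejesToth1943_sphereCovering` — the NAMED FACT (statement only; NOT discharged here).  Discharging it means porting
  the Dirichlet-cell / Jensen argument of *Lagerungen* V (each cell of the covering lies in the cap, the cap's area
  dominates that of the cell's circumscribed regular polygon, and Jensen over the `n` cells with `2n − 4` triangles).
* PROVED API: `FejesToth1943_sphereCovering.cot_omega_nonneg` (`cot ω_n ≥ 0` for `n ≥ 3`) and the cosine form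
  `FejesToth1943_sphereCovering.cos_le` (`cos θ ≤ cot ω_n / √3`), which is what quantitative users need.

## Sources
L. Fejes Tóth, *Covering a spherical surface with equal spherical caps* (in Hungarian), Mat. Fiz. Lapok **50** (1943)
40–46 (MR 8, 219); *Lagerungen* (1953), Kap. V; secondary:
H. S. M. Coxeter, *The Beauty of Geometry: Twelve Essays* (Dover 1999), p. 145 ("the circum-circles of the faces of
`{p, 3}` give the thinnest covering", `cos χ = 3^{-1/2} cot (π/p)`, citing *Lagerungen* p. 58);
Croft–Falconer–Guy, *Unsolved Problems in Geometry* (1991), D8 (exact thinnest coverings known for `n ≤ 7, 10, 12, 14`);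
Brass–Moser–Pach, *Research Problems in Discrete Geometry* (2005), p. 35 (thinnest coverings of the sphere by `n` equal caps;
refs pp. 39–40).  The check values of the typed formula at the equality cases: `n = 3`: `90°`, `n = 4`: `70.53°`, `n = 6`: `54.74°`, `n = 12`: `37.38°`.

## Not here
The packing twin (it is `FejesTothTammesBound.lean`); numerical thinnest coverings for other `n` (Tarnai–Gáspár);
higher dimensions.
-/

noncomputable section

namespace Literature.Geometry.DiscreteGeometry

/-- **L. Fejes Tóth's sphere-covering theorem (1943; *Lagerungen*, Kap. V).**  If `n ≥ 3` congruent closed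
spherical caps of angular radius `θ ∈ [0, π]` cover the unit sphere `S² ⊂ ℝ³`, then
`θ ≥ arccos (cot ω_n / √3)`, where `ω_n = n·π / (6(n − 2))` (half the angle of the regular spherical
triangle of the `{3, n}`-type subdivision); equality exactly for `n = 3, 4, 6, 12` (great circle / tetrahedron /
octahedron / icosahedron circum-caps).  The covering twin of the Tammes bound `fejesToth_inner_bound`
(`FejesTothTammesBound.lean`); typed, like it, with `ω_n = n π / (6 (n − 2))`, and over an indexed family
`a : Fin n → ℝ³` of unit cap centres ("`n` caps", repetitions allowed, as in print).  Secondary statements of the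
same theorem: Coxeter, *The Beauty of Geometry: Twelve Essays* (Dover 1999), essay 9 p. 145 (the circum-circles of the faces of
`{p, 3}` give the thinnest covering, `cos χ = 3^{-1/2} cot (π/p)`, citing *Lagerungen* p. 58);
Croft–Falconer–Guy, *Unsolved Problems in Geometry* (1991), D8; original: L. Fejes Tóth, *Mat. Fiz. Lapok* 50
(1943) 40–46.  NOT discharged here (statement only).
[cite: FejesToth1953, Kap. V (covering of the sphere by n congruent caps: ρ_n ≥ arccos (cot ω_n / √3), ω_n = nπ/(6(n−2)))] -/
def FejesToth1943_sphereCovering : Prop :=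
  ∀ (n : ℕ) (θ : ℝ) (a : Fin n → EuclideanSpace ℝ (Fin 3)), 3 ≤ n → 0 ≤ θ → θ ≤ Real.pi →
    (∀ i, ‖a i‖ = 1) →
    {x : EuclideanSpace ℝ (Fin 3) | ‖x‖ = 1} ⊆ (⋃ i, sphCap (a i) θ) →
      Real.arccos (Real.cot ((n : ℝ) * Real.pi / (6 * ((n : ℝ) - 2))) / Real.sqrt 3) ≤ θ

namespace FejesToth1943_sphereCovering

/-- For `n ≥ 3` the angle `ω_n = nπ/(6(n−2))` lies in `(0, π/2]`, so `cot ω_n ≥ 0`.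
[cite: FejesToth1953, Kap. V (covering of the sphere by n congruent caps)] -/
theorem cot_omega_nonneg {n : ℕ} (hn : 3 ≤ n) :
    0 ≤ Real.cot ((n : ℝ) * Real.pi / (6 * ((n : ℝ) - 2))) := by
  set ω := (n : ℝ) * Real.pi / (6 * ((n : ℝ) - 2)) with hω
  have hN : (3 : ℝ) ≤ n := by exact_mod_cast hn
  have hN2 : (0 : ℝ) < (n : ℝ) - 2 := by linarith
  have hω0 : 0 < ω := by rw [hω]; positivity
  have hωle : ω ≤ Real.pi / 2 := by
    rw [hω, div_le_iff₀ (by positivity)]; nlinarith [Real.pi_pos]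
  rw [Real.cot_eq_cos_div_sin]
  exact div_nonneg (Real.cos_nonneg_of_neg_pi_div_two_le_of_le (by linarith) hωle)
    (Real.sin_nonneg_of_nonneg_of_le_pi hω0.le (by linarith [Real.pi_pos]))

/-- **Cosine form.**  Under the fact: a covering of `S²` by `n ≥ 3` caps of angular radius `θ ∈ [0, π]` has
`cos θ ≤ cot ω_n / √3`. [cite: FejesToth1953, Kap. V (covering of the sphere by n congruent caps)] -/
theorem cos_le (h : FejesToth1943_sphereCovering) {n : ℕ} {θ : ℝ}
    {a : Fin n → EuclideanSpace ℝ (Fin 3)} (hn : 3 ≤ n) (h0 : 0 ≤ θ) (hπ : θ ≤ Real.pi)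
    (ha : ∀ i, ‖a i‖ = 1)
    (hcov : {x : EuclideanSpace ℝ (Fin 3) | ‖x‖ = 1} ⊆ (⋃ i, sphCap (a i) θ)) :
    Real.cos θ ≤ Real.cot ((n : ℝ) * Real.pi / (6 * ((n : ℝ) - 2))) / Real.sqrt 3 := by
  set v := Real.cot ((n : ℝ) * Real.pi / (6 * ((n : ℝ) - 2))) / Real.sqrt 3 with hv
  have hv0 : 0 ≤ v := div_nonneg (cot_omega_nonneg hn) (Real.sqrt_nonneg _)
  have hθ : Real.arccos v ≤ θ := h n θ a hn h0 hπ ha hcov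
  by_cases hv1 : v ≤ 1
  · calc Real.cos θ ≤ Real.cos (Real.arccos v) :=
          Real.cos_le_cos_of_nonneg_of_le_pi (Real.arccos_nonneg v) hπ hθ
      _ = v := Real.cos_arccos (by linarith) hv1
  · exact (Real.cos_le_one θ).trans (le_of_lt (not_le.1 hv1))

end FejesToth1943_sphereCovering

end Literature.Geometry.DiscreteGeometry

end
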